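import Summits.BirchSwinnertonDyer.Rank1Residual.X11b.BDPRouteSelmerCardBoundTorsion
import HarnessLib

/-!
# Class X11b, route "BDP + converse-theorem engine + Kolyvagin" (p2): the Selmer count and the
# control input at a DATUM, for EVERY prime (cell `b2b-bsdres`, sub-cell `multr1-p2`, gen 18)

HONEST FRAMING (verbatim, cell `b2b-bsdres`, run/shared/lean/b2b/bsd-rank1-residual/): the goal of
the cell is to DELETE the COMBINATION-SHAPED residual classes for ALL analytic-rank `≤ 1` curves
over `ℚ` — "full BSD formula for every rank `≤ 1` curve in class `C`" assembled STRICTLY from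
published theorems — so that the rank-`≤ 1` remainder becomes exactly the CONSTRUCTION-SHAPED
classes, which are TYPED (missing-input Props), NOT attempted; this is not "finishing BSD".
Research route `p2` for class X11b; no claim beyond the stated class and loci; nothing booked;
X11b stays CONSTRUCTION-SHAPED. THEOREMS ONLY (no definition, no named fact, no `sorry`).

## What this file does

Gen 17's `p2SelmerCardBoundTorsion_of_facts` / `p2ControlUpperOnTreeAt_of_facts` prove the
torsion-weighted Selmer count and the control input (T1ᵗ-CTL≤) in the shape of the CLASS-LEVEL
predicates of the statement of record, whose antecedents include `ClassX11b W p`, `5 ≤ p`, `Surj W p`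
and the odd-`d_K` Manin-good conditions of the route's Heegner data. The PROOF used none of these
beyond: `p` multiplicative, `E[p]` irreducible, `K` imaginary quadratic with the Heegner hypothesis for
`N_E`, the Heegner point `P` non-torsion (for Kolyvagin), `𝔭 ∋ p` of degree one. This file restates
both at a DATUM with exactly those hypotheses — in particular for EVERY prime `p` (so `p = 3`):

* `selmerCardBoundTorsion_datum_of_facts` — `Sel_𝔭(K,E[p^∞])` finite and
  `#Sel_𝔭(K,E[p^∞]) · #E(ℚ_p)[p^∞] ≤ p^a`,
  `a ≤ ord_p #Ш(E/K)[p^∞] + 2((ord_p log_ω P − 1) − ord_p[E(K):ℤP]) + ord_p ∏_{w∣p} c_w(E/K)`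
  (Cas18 (3.2.1)+(calcul) `≤` / JSW17 Prop. 3.2.1), from Kolyvagin + Poitou–Tate (Milne I 4.10(b)) +
  local Euler characteristic (Milne I 2.8) — the proof is gen 17's, verbatim;
* `controlUpperOnTreeAt_datum_of_facts` — (CTL≤)ᵗ `ControlUpperOnTreeAt p κ 𝔭 γ (embAt K p 𝔭) P`
  for every anticyclotomic `κ` and generator `γ` (Cas18 Thm. 2.3 `≤` on the constructed `X_ac`), by
  gen 17's `controlUpperOnTreeAt_of_selmerCardBound_torsion`.

Consumers: `BDPRouteOddOnTree.lean` (the route at every odd prime, `p = 3` included); route R1 may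
use the datum form directly. CONDITIONAL on the three named facts; nothing booked.

References: [Castella2018] Thm. 2.3, (3.2.1), (calcul) (arXiv:1704.06608 pp. 5–6);
[JetchevSkinnerWan2017] Prop. 3.2.1, (7.1.5); [GreenbergLNM1716] §3 Lemma 3.3; [MilneADT2006] I 2.8,
4.10(b); [Kolyvagin1990] Thm. A; [Gross1991] Thm. 1.3.
-/

noncomputable section

open scoped Classical

open WeierstrassCurve NumberField IsDedekindDomain Field
open Literature.NumberTheory.EllipticCurves Literature.NumberTheory.EllipticCurves.GreenbergSelmer
  Literature.NumberTheory.EllipticCurves.ModularForms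
  Literature.NumberTheory.EllipticCurves.Rank1Residual
  Literature.NumberTheory.EllipticCurves.Rank1Residual.Typed
  Literature.NumberTheory.EllipticCurves.Wuthrich2014
  Literature.NumberTheory.EllipticCurves.BalakrishnanEtAl2019
  Literature.NumberTheory.QuadraticFields.Quadratic
  Literature.NumberTheory.Automorphic
  Literature.NumberTheory.GaloisRepresentations Literature.NumberTheory.GaloisCohomology
  Summit.BirchSwinnertonDyer.Rank1Residual.X11b.AcSelmer
  Summit.BirchSwinnertonDyer.Rank1Residual.X11b.LocBridge

namespace Summit.BirchSwinnertonDyer.Rank1Residual.X11b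

/-! ### §1. The Selmer count and the control input at a DATUM, every prime -/

section Datum

/-- **The torsion-weighted Selmer count at a DATUM, ANY prime `p`.** For a globally minimal
elliptic `W/ℚ`, a prime `p` of multiplicative reduction with `E[p]` irreducible, an imaginary
quadratic `K` with the Heegner hypothesis for `N_E`, a Heegner point `P` of infinite order of a
parametrisation datum, and a degree-one prime `𝔭 ∋ p` of `𝓞_K`: Castella's `Sel_𝔭(K, E[p^∞])` is
finite with `#Sel_𝔭(K,E[p^∞]) · #E(ℚ_p)[p^∞] ≤ p^a`,
`a ≤ ord_p #Ш(E/K)[p^∞] + 2((ord_p log_ω P − 1) − ord_p[E(K):ℤP]) + ord_p ∏_{w∣p} c_w(E/K)` — the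
`≤` half of Cas18 (3.2.1)+(calcul) / JSW17 Prop. 3.2.1, from Kolyvagin (`rank E(K) = 1`, `Ш(E/K)`
finite), Poitou–Tate (Milne I 4.10(b)), Tate's local Euler characteristic (Milne I 2.8) and
`E(K)[p] = 0` (from `Irr`, `K` quadratic). Gen 17's `p2SelmerCardBoundTorsion_of_facts` VERBATIM with
the class antecedents (`ClassX11b`, `5 ≤ p`, `Surj`, `d_K` odd, `p ∤ d_K`, `p ∤ w_K`,
`L(E^{d_K},1) ≠ 0`, `p ∤ c`) dropped — its proof never used them. CONDITIONAL on the named facts.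
[cite: Castella2018, proof of Thm. 2.3, (3.2.1) and (calcul) (arXiv:1704.06608 pp. 5–6)]
[cite: JetchevSkinnerWan2017, Prop. 3.2.1 and (7.1.5) (arXiv:1512.06894 pp. 10–11, 16)]
[cite: MilneADT2006, Ch. I, Thm. 4.10(b) and Thm. 2.8] [cite: Kolyvagin1990, Thm. A] [cite: Gross1991, Thm. 1.3] -/
theorem selmerCardBoundTorsion_datum_of_facts (W : WeierstrassCurve ℚ) [W.IsElliptic]
    [W.IsGloballyMinimal] (p : ℕ) [Fact p.Prime]
    (hKo : ∀ (N : ℕ) [NeZero N] (W : WeierstrassCurve ℚ) (K : Type) [Field K] [NumberField K],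
      kolyvagin N W K)
    (hPT : ∀ (K : Type) [Field K] [NumberField K], poitouTate_sum_localTatePairing_eq_zero K)
    (hEP : ∀ (K : Type) [Field K] [NumberField K] (v : HeightOneSpectrum (𝓞 K)),
      localEulerPoincareCharacteristic (v.adicCompletion K))
    (N : ℕ) [NeZero N] (K : Type) [Field K] [NumberField K]
    (Dt : ModularParametrizationData W N) (Hg : HeegnerDatum N (NumberField.discr K)) (ι : K →+* ℂ)
    (P : (W.baseChange K).toAffine.Point)
    (hmult : Mult W p) (hirr : Irr W p) (hN : W.conductorNorm ℤ = N) (hK : IsImaginaryQuadratic K)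
    (hHN : SatisfiesHeegnerHypothesis N K)
    (hP : WeierstrassCurve.Affine.Point.map ι.toRatAlgHom P = heegnerPointComplex Dt Hg)
    (hPinf : ¬ IsOfFinAddOrder P)
    (𝔭 : HeightOneSpectrum (𝓞 K)) (h𝔭 : ((p : ℕ) : 𝓞 K) ∈ 𝔭.asIdeal)
    (he : 𝔭.asIdeal.ramificationIdx (𝓞 ℚ) = 1) (hf : 𝔭.asIdeal.inertiaDeg (𝓞 ℚ) = 1) :
    ∃ (_ : Finite (selmerAcBase (W.baseChange K) p 𝔭 ∅)) (a : ℕ),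
      Nat.card (selmerAcBase (W.baseChange K) p 𝔭 ∅) *
          Nat.card (AddCommGroup.primaryComponent (W.baseChange ℚ_[p]).toAffine.Point p) ≤
        p ^ a ∧
      (a : ℤ) ≤
        (padicValNat p (Nat.card (AddCommGroup.primaryComponent (W.baseChange K).sha p)) : ℤ) +
        2 * ((padicLogOrd W p (embAt K p 𝔭 h𝔭 he hf) P - 1) -
          (padicValNat p (AddSubgroup.zmultiples P).index : ℤ)) +
          padicValNat p (tamagawaProductAbove W K p) := by
  revert P
  set E := W.baseChange K with hEdef
  set G := W.baseChange ℚ_[p] with hGdef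
  intro P hP hPinf
  haveI hEK : E.IsElliptic := by rw [hEdef, baseChange]; infer_instance
  have hpN : p ∣ W.conductorNorm ℤ := dvd_conductorNorm_of_mult hmult
  have hsplit : SplitsIn K p := hHN p Fact.out (hN ▸ hpN)
  have h2 : Module.finrank ℚ K = 2 := hK.1
  have hp : p.Prime := Fact.out
  -- Kolyvagin: `rank E(K) = 1`, `Ш(E/K)` finite
  obtain ⟨hrank, hSha⟩ := hKo N W K hK hHN ⟨Dt, Hg, ι, hP⟩ hPinf
  haveI hShaFin : Finite E.sha := hSha
  set ιp := embAt K p 𝔭 h𝔭 he hf with hιp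
  set f : E.toAffine.Point →+ G.toAffine.Point := Affine.Point.map (W' := W) ιp.toRatAlgHom with hfdef
  have hfapply : ∀ x, f x = padicPointOf W p ιp x := fun _ => rfl
  have hfinj : Function.Injective f := Affine.Point.map_injective (W' := W) ιp.toRatAlgHom
  -- no `p`-torsion in `E(K)` (from `Irr`, `K` quadratic)
  have hivK : ∀ x : E.toAffine.Point, p • x = 0 → x = 0 :=
    Transvection.forall_torsion_eq_zero_of_irr W p hirr K h2
  -- a coordinate `c : E(K) → ℤ` and a generator `Q`
  obtain ⟨c, Q, hcQ, hcker⟩ := RankOne.exists_coord_of_mordellWeilRank_eq_one E hrank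
  have hA : ∀ a : E.toAffine.Point, IsOfFinAddOrder (a - c a • Q) :=
    RankOne.isOfFinAddOrder_sub_coord_zsmul c Q hcQ hcker
  have hQinf : ¬ IsOfFinAddOrder Q := fun hQ => by
    have h := RankOne.coord_eq_zero_of_isOfFinAddOrder c hQ
    rw [hcQ] at h
    exact one_ne_zero h
  have hxinf : ¬ IsOfFinAddOrder (f Q) := fun hx => hQinf ((hfinj.isOfFinAddOrder_iff).mp hx)
  have hyinf : ¬ IsOfFinAddOrder (f P) := fun hy => hPinf ((hfinj.isOfFinAddOrder_iff).mp hy)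
  have hcP : c P ≠ 0 := fun h0 => hPinf (hcker P h0)
  -- the `ℤ_p`-coordinate `Ψ` on `E(ℚ_p)`: `Ψ(E(ℚ_p)) = p^m ℤ_p`, `p^m = #E(ℚ_p)[p^∞]`
  haveI hfi2 : (G.formalFiltration 2).FiniteIndex := G.finiteIndex_formalFiltration 2
  set cp := padicValNat p (G.localTamagawaNumber ℤ_[p]) with hcpdef
  obtain ⟨φ, hφ⟩ := LocalIndex.exists_addEquiv_valuation_psi_padicPointOf_of_mult W p hmult (K := K)
  obtain ⟨m, hmrange, hmcard, hmle⟩ :=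
    LocalIndex.exists_pow_eq_card_and_le_valuation_psi (G.formalFiltration 2) φ
  set Ψ := LocalIndex.psi (G.formalFiltration 2) φ with hΨ
  set eQ := (Ψ (f Q)).valuation with heQdef
  set eP := (Ψ (f P)).valuation with hePdef
  have hΨQ : Ψ (f Q) ≠ 0 := fun h0 => hxinf ((LocalIndex.psi_eq_zero_iff _ φ _).mp h0)
  have hmeQ : m ≤ eQ := hmle (f Q) hΨQ
  -- the exponents: `e(P) = padicLogOrd P + c_p − 1`, `e(P) = ord_p c(P) + e(Q)`
  have heP : (eP : ℤ) = padicLogOrd W p ιp P + cp - 1 := hφ ιp P hyinf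
  have hyx : f P = c P • f Q + f (P - c P • Q) := by rw [map_sub, map_zsmul]; abel
  have hePQ : eP = padicValNat p (c P).natAbs + eQ := by
    rw [hePdef, hyx]
    exact LocalIndex.valuation_psi_zsmul_add (G.formalFiltration 2) φ hxinf
      (f.isOfFinAddOrder (hA P)) hcP
  -- `ord_p [E(K) : ℤP] = ord_p |c(P)|`
  haveI : Finite (AddCommGroup.torsion E.toAffine.Point) := E.finite_torsion_point
  have hI : padicValNat p (AddSubgroup.zmultiples P).index = padicValNat p (c P).natAbs :=
    RankOne.padicValNat_index_zmultiples_eq c Q hcQ hcker hivK P hcP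
  -- (v) `ord_p ∏_{w∣p} c_w = 2 ord_p c_p`
  have htam : padicValNat p (tamagawaProductAbove W K p) = 2 * cp :=
    LocalIndexTransport.padicValNat_tamagawaProductAbove_eq_two_mul W K p h2 hsplit
  -- the two primes above `p`
  obtain ⟨σ, 𝔮, hσ, -, -, hall⟩ := LocalIndexTransport.exists_conj_prime_of_splitsIn K p h2 hsplit h𝔭
  have h𝔮 : ∀ v : HeightOneSpectrum (𝓞 K), v ≠ 𝔭 → ((p : ℕ) : 𝓞 K) ∈ v.asIdeal → v = 𝔮 :=
    fun v hv hpv => (hall v hpv).resolve_left hv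
  -- `Ш[p^k] ⊆ Ш[p^∞]`, `#Ш[p^∞] = p^v`
  set S := Nat.card (AddCommGroup.primaryComponent E.sha p) with hSdef
  obtain ⟨v, hv⟩ : ∃ v : ℕ, S = p ^ v := exists_natCard_primaryComponent_eq_pow p
  -- THE LEVEL BOUNDS
  set B : ℕ := (p ^ (eQ - m) * p ^ m) * (S * p ^ (eQ - m)) with hBdef
  have hlevel : ∀ k, Finite (acLevelStructure E p k 𝔭 ∅).selmerGroup ∧
      Nat.card (acLevelStructure E p k 𝔭 ∅).selmerGroup ≤ B := by
    intro k
    rcases Nat.eq_zero_or_pos k with rfl | hk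
    · obtain ⟨hfin, hle⟩ := finite_and_natCard_selmerGroup_acLevelStructure_zero E p 𝔭 ∅
      refine ⟨hfin, hle.trans ?_⟩
      have hS1 : 1 ≤ S := by rw [hv]; exact Nat.one_le_pow _ _ hp.pos
      calc 1 ≤ S := hS1
        _ ≤ S * p ^ (eQ - m) := Nat.le_mul_of_pos_right _ (pow_pos hp.pos _)
        _ ≤ (p ^ (eQ - m) * p ^ m) * (S * p ^ (eQ - m)) :=
            Nat.le_mul_of_pos_left _ (Nat.mul_pos (pow_pos hp.pos _) (pow_pos hp.pos _))
    · -- the indices at level `k`, read in `E(ℚ_p)` through `Ψ`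
      have hL₁ : ((Affine.Point.baseChange (W' := W.baseChange K) K (𝔭.adicCompletion K)).range ⊔
          (zsmulAddGroupHom ((p ^ k : ℕ) : ℤ) :
            ((W.baseChange K).baseChange (𝔭.adicCompletion K)).toAffine.Point →+ _).range).index ≤
          p ^ min k (eQ - m) * p ^ m := by
        rw [LocalIndexTransport.index_range_baseChange_sup_eq_padic K p 𝔭 h𝔭 he hf W,
          RankOne.range_zsmulAddGroupHom_natCast, sup_comm]
        change ((nsmulAddMonoidHom (p ^ k) : G.toAffine.Point →+ _).range ⊔ f.range).index ≤ _
        rw [LocalIndex.range_nsmul_sup_range_eq_of_source f c Q hA k hivK, hmcard]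
        exact LocalIndex.index_range_nsmul_sup_zmultiples_le (G.formalFiltration 2) φ hmrange
          (f Q) hxinf k
      have hM : (AddCommGroup.torsion ((W.baseChange K).baseChange (𝔭.adicCompletion K)).toAffine.Point ⊔
          (zsmulAddGroupHom ((p ^ k : ℕ) : ℤ) :
            ((W.baseChange K).baseChange (𝔭.adicCompletion K)).toAffine.Point →+ _).range).index =
          p ^ k := by
        rw [index_torsion_sup_range_zsmul_eq_padic K p 𝔭 h𝔭 he hf W,
          RankOne.range_zsmulAddGroupHom_natCast]
        exact LocalIndex.index_torsion_sup_range_nsmul (G.formalFiltration 2) φ k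
      have hN : ((zsmulAddGroupHom ((p ^ k : ℕ) : ℤ) : E.toAffine.Point →+ _).range).index =
          p ^ k := RankOne.index_range_zsmul_pow_eq c Q hcQ hcker hivK k
      have hL₂ : ((Affine.Point.baseChange (W' := W.baseChange K) K (𝔭.adicCompletion K)).range ⊔
          (AddCommGroup.torsion ((W.baseChange K).baseChange (𝔭.adicCompletion K)).toAffine.Point ⊔
            (zsmulAddGroupHom ((p ^ k : ℕ) : ℤ) :
              ((W.baseChange K).baseChange (𝔭.adicCompletion K)).toAffine.Point →+ _).range)).index =
          p ^ min k (eQ - m) := by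
        rw [index_range_baseChange_sup_torsion_sup_eq_padic K p 𝔭 h𝔭 he hf W,
          RankOne.range_zsmulAddGroupHom_natCast]
        change (f.range ⊔ (AddCommGroup.torsion G.toAffine.Point ⊔
          (nsmulAddMonoidHom (p ^ k) : G.toAffine.Point →+ _).range)).index = _
        have hrw : f.range ⊔ (AddCommGroup.torsion G.toAffine.Point ⊔
            (nsmulAddMonoidHom (p ^ k) : G.toAffine.Point →+ _).range) =
            AddCommGroup.torsion G.toAffine.Point ⊔
              ((nsmulAddMonoidHom (p ^ k) : G.toAffine.Point →+ _).range ⊔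
                AddSubgroup.zmultiples (f Q)) := by
          rw [← LocalIndex.range_nsmul_sup_range_eq_of_source f c Q hA k hivK]
          ac_rfl
        rw [hrw]
        exact LocalIndex.index_torsion_sup_range_nsmul_sup_zmultiples (G.formalFiltration 2) φ
          hmrange (f Q) hxinf k
      obtain ⟨hfin, hle⟩ := SelmerLevelBound.natCard_level_le_of_indices_torsion W K p k 𝔭 𝔮 hk
        σ hσ h𝔮 (hPT K) (hEP K 𝔮) rfl hM (pow_ne_zero _ hp.ne_zero) hN hL₂
        (natCard_sha_inf_torsionBy_le E p k)
      refine ⟨hfin, hle.trans ?_⟩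
      have hmin : p ^ min k (eQ - m) ≤ p ^ (eQ - m) := Nat.pow_le_pow_right hp.pos (min_le_right _ _)
      exact Nat.mul_le_mul (hL₁.trans (Nat.mul_le_mul_right _ hmin))
        (Nat.mul_le_mul_left _ hmin)
  -- pass to the limit
  obtain ⟨hfinSel, hcard⟩ := LevelKummer.exists_finite_selmerAcBase_natCard_le E p 𝔭 ∅
    E.zsmul_geomPoints_surjective_holds B (fun k => (hlevel k).1) (fun k => (hlevel k).2)
  refine ⟨hfinSel, v + 2 * eQ, ?_, ?_⟩
  · rw [← hmcard]
    calc Nat.card (selmerAcBase E p 𝔭 ∅) * p ^ m ≤ B * p ^ m := Nat.mul_le_mul_right _ hcard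
      _ = p ^ (v + 2 * eQ) := by
          rw [hBdef, hv, ← pow_add, ← pow_add, ← pow_add, ← pow_add]
          congr 1
          omega
  · have hvS : padicValNat p S = v := by rw [hv, padicValNat.prime_pow]
    rw [hvS, hI, htam]
    have hePQZ : (eP : ℤ) = (padicValNat p (c P).natAbs : ℤ) + (eQ : ℤ) := by exact_mod_cast hePQ
    have hcast : (((v + 2 * eQ : ℕ) : ℤ)) = (v : ℤ) + 2 * (eQ : ℤ) := by push_cast; ring
    have hcast2 : (((2 * cp : ℕ) : ℤ)) = 2 * (cp : ℤ) := by push_cast; ring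
    rw [hcast, hcast2]
    linarith [hePQZ, heP]


variable {W : WeierstrassCurve ℚ} [W.IsElliptic] [W.IsGloballyMinimal] {K : Type} [Field K]
  [NumberField K] {p : ℕ} [Fact p.Prime]

/-- **(CTL≤)ᵗ at a DATUM from published facts, ANY prime `p`**: for `(W, p, K, P, 𝔭)` as in
`selmerCardBoundTorsion_datum_of_facts` and every anticyclotomic `ℤ_p`-extension `κ` with
topological generator `γ`: `ControlUpperOnTreeAt p κ 𝔭 γ (embAt K p 𝔭) P` (Cas18 Thm. 2.3 `≤` on
the constructed `X_ac`). §1's count fed to gen 17's datum theorem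
`controlUpperOnTreeAt_of_selmerCardBound_torsion` (Greenberg Lemmas 3.2/3.3, counting snake lemma,
away descent). CONDITIONAL on the three named facts.
[cite: Castella2018, Thm. 2.3 and its proof (arXiv:1704.06608 pp. 5–6)] [cite: GreenbergLNM1716, §3 Lemma 3.3 (p. 87), p. 90]
[cite: MilneADT2006, Ch. I, Thm. 4.10(b) and Thm. 2.8] [cite: Kolyvagin1990, Thm. A] -/
theorem controlUpperOnTreeAt_datum_of_facts
    (hKo : ∀ (N : ℕ) [NeZero N] (W : WeierstrassCurve ℚ) (K : Type) [Field K] [NumberField K],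
      kolyvagin N W K)
    (hPT : ∀ (K : Type) [Field K] [NumberField K], poitouTate_sum_localTatePairing_eq_zero K)
    (hEP : ∀ (K : Type) [Field K] [NumberField K] (v : HeightOneSpectrum (𝓞 K)),
      localEulerPoincareCharacteristic (v.adicCompletion K))
    {N : ℕ} [NeZero N] (Dt : ModularParametrizationData W N) (Hg : HeegnerDatum N (NumberField.discr K))
    (ι : K →+* ℂ) {P : (W.baseChange K).toAffine.Point}
    (hmult : Mult W p) (hirr : Irr W p) (hN : W.conductorNorm ℤ = N) (hK : IsImaginaryQuadratic K)
    (hHN : SatisfiesHeegnerHypothesis N K)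
    (hP : WeierstrassCurve.Affine.Point.map ι.toRatAlgHom P = heegnerPointComplex Dt Hg)
    (hPinf : ¬ IsOfFinAddOrder P)
    {κ : ZpExtension K p} (hκ : κ.IsAnticyclotomic) (γ : Field.absoluteGaloisGroup K)
    [Fact (κ.IsTopGenerator γ)]
    (𝔭 : HeightOneSpectrum (𝓞 K)) (h𝔭 : ((p : ℕ) : 𝓞 K) ∈ 𝔭.asIdeal)
    (he : 𝔭.asIdeal.ramificationIdx (𝓞 ℚ) = 1) (hf : 𝔭.asIdeal.inertiaDeg (𝓞 ℚ) = 1) :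
    ControlUpperOnTreeAt p κ 𝔭 γ (embAt K p 𝔭 h𝔭 he hf) P := by
  haveI : IsTotallyComplex K := hK.2
  have hpN : p ∣ W.conductorNorm ℤ := dvd_conductorNorm_of_mult hmult
  have hsplit : SplitsIn K p := hHN p Fact.out (hN ▸ hpN)
  obtain ⟨hfin, a, ha, hm⟩ := selmerCardBoundTorsion_datum_of_facts W p hKo hPT hEP N K Dt Hg ι P
    hmult hirr hN hK hHN hP hPinf 𝔭 h𝔭 he hf
  haveI := hfin
  exact controlUpperOnTreeAt_of_selmerCardBound_torsion hK.1 hκ h𝔭 he hf hsplit hpN ha hm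

end Datum

end Summit.BirchSwinnertonDyer.Rank1Residual.X11b

end
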